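/-
Copyright (c) 2026 the pub-hodgecm-mathlib formalisation cell (harness21).  Prover seat hodgecm-mathlib-K2E1-p16 (g2), Track B ∕ K2-LIT, h413 = `stmt-HodgeConjecture-24833`,
route of record `HCCMUnconditional`; R90-TF section S8 «ContSpec-n½» (dealer R90-CS-plan (g0), LEAD K2E1-plan (g7)), «U(Φ₃) χ-TWIN #2» dealt BY NAME 16:10:27Z (TWIN-DAG v1 row 3,
RULING S8-R10 (a): INDEXING-FREE): the N = 3 twin of ★ `K2E1ChiEisensteinMemHXCMTwo` (K2E1-p10 (g2)) over the ★ U3 spherical supplier `K2E1BLEisensteinMemHXCMThree` (K2E1-p09).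
-/
import Summits.HodgeConjecture.HodgeConjecture.Theorems.K2E1BLEisensteinMemHXCMThree                  -- ★ (K2E1-p09) (b1)₃: `exists_pos_forall_le_supHeight_cm_three`; brings ★ RANK-GENERIC `norm_toHX_le_of_norm_le_mul_supHeight_pow`, `measurable_supHeight`, `memLp_two_withDensity_supHeight_of_norm_le_mul_pow`, `supHeight_eq_ciSup_arithmetic`, ★ `continuous_eisensteinSeriesU_flatSectionU_cm_three`, ★ `K2E1EisensteinCompactRangeMajorantCMThree.tsum_borelHeight_rpow_le_uniform_cm_three`
import Summits.HodgeConjecture.HodgeConjecture.Theorems.K2E1BorelEisensteinGodementCMThree                -- ★ Godement at N = 3: `summable_borelHeight_rpow_cm_three`, `summable_eisensteinSeriesU_flatSectionU_cm_three` (bounded `φ`, `2 < Re z`)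
import Summits.HodgeConjecture.HodgeConjecture.Theorems.K2E1CharacterEisensteinU2Defs                      -- ★ p859441 (K2-defs1 g6): `IsChiSection` (rank-generic `(quasiSplit F E c N)`), `.toAdelic_mul` (left-`B(F)`-invariance)
import Summits.HodgeConjecture.HodgeConjecture.Theorems.K2E1BorelEisensteinGodementU3                     -- ★ `norm_flatSectionU_le` (`‖f_z(x)‖ ≤ M·H(x)^{Re z}`, every rank)
import HarnessLib

/-!
# h413 ∕ Track B «K2-LIT», S8 «U(Φ₃) χ-TWIN #2» — helper `K2E1ChiEisensteinMemHXCMThree` (TWIN-DAG v1 row 3): `E(f_z) ∈ 𝓗_k(𝔛)` FOR BOUNDED LEFT-`B(F)`-INVARIANT SECTIONS ON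
# `U(2,1)_{L∕L⁺} = U(Φ₃)`, `2 < Re z ≤ k`, AND THE `𝓗_k`-NORM BOUND UNIFORM ON `{σ₁ ≤ Re z ≤ k}` — the N = 3 twin of ★ `K2E1ChiEisensteinMemHXCMTwo` (`1 < Re z` there; the N = 3
# Godement range is `2 < Re z`, ★ `K2E1BorelEisensteinGodementCMThree`)

Cell `pub/hodgecm-mathlib`, crux h413 = `stmt-HodgeConjecture-24833`, route of record `HCCMUnconditional`; R90-TF section S8 (Rogawski 1990 §13.9; the twins feed R1₃ of S8B#2's road AND
E-S8-def-cont, R90-CS-plan 16:06:43Z), deal «TWIN #2» 16:10:27Z under RULING S8-R10 (a) «twins are typed INDEXING-FREE wherever the N = 2 original uses the section only through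
left-`B(F)`-invariance + measurability ∕ growth».  THEOREMS ONLY (no `def`, no `instance`, no notation, no named-fact hypothesis, no `sorry`); lane `--supports stmt-HodgeConjecture-24833
--as helper` (count-neutral).  Closes no socket.

THE POINT (as at N = 2).  In ★ (b1)₃ `K2E1BLEisensteinMemHXCMThree` the section is hard-wired `φ ≡ φ₀` in exactly one place, the pointwise majorant `‖E(φ₀H^z)(g)‖ ≤ ‖φ₀‖·Σ_q H(γ̃_q g)^{Re z}`;
everything downstream (the SECTION-FREE uniform majorant `Σ_q H(γ̃_q g)^σ ≤ C·w₁(g)^{σ₂}` on `[σ₁, σ₂] ⊂ (2, ∞)` ★ `K2E1EisensteinCompactRangeMajorantCMThree.tsum_borelHeight_rpow_le_uniform_cm_three`,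
the `L²(w₁^{−2k}dμ)` packaging ★ FILE C (rank-generic), Borel descent ★) is section-free.  For any `φ : G(𝔸) → ℂ` with `‖φ‖ ≤ M` the same majorant holds with `‖φ₀‖ ↦ M` (★
`norm_flatSectionU_le` + ★ Godement₃ `summable_eisensteinSeriesU_flatSectionU_cm_three`), and measurability of the descent needs only continuity of `φ` (★ `continuous_eisensteinSeriesU_flatSectionU_cm_three`,
already `φ`-general) and left-`B(F)`-invariance of `φ` (★ `eisensteinSeriesU_flatSectionU_rational_mul`, rank-generic).  §1–§3 are INDEXING-FREE (bare `φ` with the three hypotheses `hφc hφM hφB`);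
§4 reads them for `IsChiSection χ φ` (★ rank-generic def; at N = 3 this is the `χ₂ = 1` SUB-FAMILY of the Borel characters `diag(a, b, ā⁻¹) ↦ χ₁(a)χ₂(b)` — RULING S8-R10 (b): the full pair
currency `IsChiSectionPair` is D-S8-3 (K2-defs1); ONLY §4 is to be re-read on it, by the same one-line proof, since a pair-section is left-`B(F)`-invariant for the same reason).

* §1 **`norm_eisensteinSeriesU_flatSectionU_le_of_norm_le`** (`‖E(f_z)(g)‖ ≤ M·Σ_q H(γ̃_q g)^{Re z}`, `2 < Re z`), **`norm_eisensteinSeriesU_flatSectionU_le_uniform_of_norm_le_cm_three`** (ONE `C(σ₁, σ₂)`; no `δ`-binders at N = 3: the ★ U3 majorant takes only `(ν, 𝓕)`).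
* §2 `measurable_quotFun_eisensteinSeriesU_of_borel_invariant_cm_three`.
* §3 **`eisensteinSeriesU_flatSectionU_memHX_of_norm_le_cm_three`** (`E(f_z) ∈ 𝓗_k(𝔛)`, `2 < Re z ≤ k`), **`norm_toHX_eisensteinSeriesU_le_uniform_of_norm_le_cm_three`**.
* §4 THE (χ,τ) PRINTS **`chiEisenstein_memHX_cm_three`**, **`norm_toHX_chiEisenstein_le_uniform_cm_three`** (`hφB := IsChiSection.toAdelic_mul`; «χ₂ = 1 sub-family; re-read on D-S8-3»).

HONEST LABEL: HC_CM is proved only modulo the 7 printed citations (2 remaining named inputs: hLiu418 = `stmt-HodgeConjecture-24832`, h413 = `stmt-HodgeConjecture-24833`) until rung 0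
closes; this file asserts no named fact and closes no socket.
References: [BernsteinLapid2019] J. Bernstein, E. Lapid, *On the meromorphic continuation of Eisenstein series*, arXiv:1911.02342 (JAMS 37 (2024)), §4 (p. 10), §7; [MoeglinWaldspurger1995]
C. Mœglin, J.-L. Waldspurger, *Spectral Decomposition and Eisenstein Series*, I.2.2, I.2.17, II.1.5, IV.1.8; [Garrett2018] P. Garrett, *Modern Analysis of Automorphic Forms by Example*, §2.3, §3.10.
-/

set_option autoImplicit false
-- the mandated namespace repeats `HodgeConjecture.HodgeConjecture`, as in every `Theorems/*.lean` of this sub-problem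
set_option linter.dupNamespace false

noncomputable section

open MeasureTheory Measure NumberField IsDedekindDomain Set Filter MulAction
open scoped ENNReal NNReal Topology
open Literature.NumberTheory.Automorphic Literature.NumberTheory.Automorphic.UnitaryGroup AdelicGroupData
open Literature.NumberTheory.GaloisRepresentations (HeckeCharacter)
open Summit.HodgeConjecture.HodgeConjecture.Cruxes.H413.K2E1BorelEisensteinU
open Summit.HodgeConjecture.HodgeConjecture.Cruxes.H413.K2E1BLEisensteinMemHXCMTwo (norm_toHX_le_of_norm_le_mul_supHeight_pow)
open Summit.HodgeConjecture.HodgeConjecture.Cruxes.H413.K2E1BLEisensteinMemHXCMThree (exists_pos_forall_le_supHeight_cm_three)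
open Summit.HodgeConjecture.HodgeConjecture.Cruxes.H413.K2E1EisensteinCompactRangeMajorantCMThree (tsum_borelHeight_rpow_le_uniform_cm_three)
open Summit.HodgeConjecture.HodgeConjecture.Cruxes.H413.K2E1BorelEisensteinGodementCMThree (summable_borelHeight_rpow_cm_three summable_eisensteinSeriesU_flatSectionU_cm_three)
open Summit.HodgeConjecture.HodgeConjecture.Cruxes.H413.K2E1BorelEisensteinGodementU3 (norm_flatSectionU_le)
open Summit.HodgeConjecture.HodgeConjecture.Cruxes.H413.K2E1BorelEisensteinRegularCMThree (continuous_eisensteinSeriesU_flatSectionU_cm_three)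
open Summit.HodgeConjecture.HodgeConjecture.Cruxes.H413.K2E1BLEisensteinInWeightedSpaceU2Weights (memLp_two_withDensity_supHeight_of_norm_le_mul_pow supHeight_eq_ciSup_arithmetic)
open Summit.HodgeConjecture.HodgeConjecture.Cruxes.H413.K2E1BLHeckeOperatorHXU2 (measurable_supHeight)
open Summit.HodgeConjecture.HodgeConjecture.Cruxes.H413.K2E1TruncatedEisensteinL2 (measurable_quotFun_of_measurable)
open Summit.HodgeConjecture.HodgeConjecture.Cruxes.H413.K2E1CharacterEisensteinU2Defs (IsChiSection)

namespace Summit.HodgeConjecture.HodgeConjecture.Cruxes.H413.K2E1ChiEisensteinMemHXCMThree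

variable (L : Type) [Field L] [NumberField L] [IsCMField L]

/-! ## §1 The pointwise and the uniform majorant for a bounded section -/

/-- **`‖E(f_z)(g)‖ ≤ M·Σ_q H(γ̃_q g)^{Re z}`** for `Re z > 2` and `‖φ‖ ≤ M`: termwise `‖φ·H^z‖ ≤ M·H^{Re z}` (★ `norm_flatSectionU_le`), norm of the sum at most the sum of the norms
(★ Godement₃ `summable_eisensteinSeriesU_flatSectionU_cm_three`, ★ `summable_borelHeight_rpow_cm_three`). [cite: MoeglinWaldspurger1995, II.1.5] [cite: Garrett2018, §3.10] -/
theorem norm_eisensteinSeriesU_flatSectionU_le_of_norm_le {φ : (quasiSplit (↥(maximalRealSubfield L)) L (IsCMField.complexConj L) 3).Adelic → ℂ} {M : ℝ} (hφM : ∀ x, ‖φ x‖ ≤ M)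
    {z : ℂ} (hz : 2 < z.re) (g : (quasiSplit (↥(maximalRealSubfield L)) L (IsCMField.complexConj L) 3).Adelic) :
    ‖eisensteinSeriesU (flatSectionU φ z) g‖ ≤ M * (∑' q : Quotient (MulAction.orbitRel ↥(borelU ((IsCMField.complexConj L : L ≃ₐ[↥(maximalRealSubfield L)] L) : L →+* L) ((StdForm.antidiagonal 3).over L))
        ↥(unitaryGroupOfForm ((IsCMField.complexConj L : L ≃ₐ[↥(maximalRealSubfield L)] L) : L →+* L) ((StdForm.antidiagonal 3).over L))),
      ((borelHeight (((quasiSplit (↥(maximalRealSubfield L)) L (IsCMField.complexConj L) 3).toAdelic (Quotient.out q : ↥(unitaryGroupOfForm ((IsCMField.complexConj L : L ≃ₐ[↥(maximalRealSubfield L)] L) : L →+* L) ((StdForm.antidiagonal 3).over L)))) * g) : ℝ)) ^ z.re) := by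
  have hs := summable_borelHeight_rpow_cm_three L hz g
  have hsn := summable_eisensteinSeriesU_flatSectionU_cm_three L hz hφM g
  rw [eisensteinSeriesU, ← tsum_mul_left]
  refine (norm_tsum_le_tsum_norm hsn).trans ?_
  exact Summable.tsum_le_tsum (fun q => norm_flatSectionU_le hφM z _) hsn (hs.mul_left M)

variable [MeasurableSpace (quasiSplit (↥(maximalRealSubfield L)) L (IsCMField.complexConj L) 3).Adelic] [BorelSpace (quasiSplit (↥(maximalRealSubfield L)) L (IsCMField.complexConj L) 3).Adelic]

/-- **UNIFORM MAJORANT OF `E(f_z)` ON `{σ₁ ≤ Re z ≤ σ₂}`** (`2 < σ₁`, `‖φ‖ ≤ M`): `‖E(f_z)(g)‖ ≤ M·C·w₁(g)^{σ₂}` with ONE `C = C(σ₁, σ₂)` for all such `z` and all `g` — §1 and the section-free ★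
`tsum_borelHeight_rpow_le_uniform_cm_three` at `σ = Re z` (section-free, no `δ`-binders at N = 3). [cite: MoeglinWaldspurger1995, II.1.5, IV.1.8] [cite: BernsteinLapid2019, §7] -/
theorem norm_eisensteinSeriesU_flatSectionU_le_uniform_of_norm_le_cm_three (ν : Measure ↥(adelicUnipotent (↥(maximalRealSubfield L)) L (IsCMField.complexConj L) 3)) [ν.IsHaarMeasure] {𝓕 : Set ↥(adelicUnipotent (↥(maximalRealSubfield L)) L (IsCMField.complexConj L) 3)}
    (h𝓕N : IsFundamentalDomain ↥(rationalUnipotent (↥(maximalRealSubfield L)) L (IsCMField.complexConj L) 3) 𝓕 ν) (h𝓕c : IsCompact (closure 𝓕))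
    {φ : (quasiSplit (↥(maximalRealSubfield L)) L (IsCMField.complexConj L) 3).Adelic → ℂ} {M : ℝ} (hφM : ∀ x, ‖φ x‖ ≤ M) {σ₁ σ₂ : ℝ} (h1 : 2 < σ₁) :
    ∃ C : ℝ, 0 ≤ C ∧ ∀ z : ℂ, σ₁ ≤ z.re → z.re ≤ σ₂ → ∀ g : (quasiSplit (↥(maximalRealSubfield L)) L (IsCMField.complexConj L) 3).Adelic,
      ‖eisensteinSeriesU (flatSectionU φ z) g‖ ≤ M * C * (((⨆ γ : (quasiSplit (↥(maximalRealSubfield L)) L (IsCMField.complexConj L) 3).arithmeticSubgroup,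
        borelHeight ((γ : (quasiSplit (↥(maximalRealSubfield L)) L (IsCMField.complexConj L) 3).Adelic) * g)) : ℝ≥0) : ℝ) ^ σ₂ := by
  have hM : 0 ≤ M := (norm_nonneg _).trans (hφM 1)
  obtain ⟨C, hC, h⟩ := tsum_borelHeight_rpow_le_uniform_cm_three L ν h𝓕N h𝓕c h1 (σ₂ := σ₂)
  refine ⟨C, hC, fun z hz₁ hz₂ g => ?_⟩
  rw [mul_assoc]
  exact (norm_eisensteinSeriesU_flatSectionU_le_of_norm_le L hφM (h1.trans_le hz₁) g).trans (mul_le_mul_of_nonneg_left (h z.re hz₁ hz₂ g) hM)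

/-! ## §2 Borel descent of `E(f_z)` to `𝔛` -/

/-- `E(f_z)` (`Re z > 2`, `φ` continuous, bounded and left-`B(F)`-invariant) is continuous (★) and left-`G(F)`-invariant (★ `eisensteinSeriesU_flatSectionU_rational_mul`), so its descent
`quotFun` to `𝔛` is Borel (★ `measurable_quotFun_of_measurable`). [cite: MoeglinWaldspurger1995, I.2.13, II.1.5] -/
theorem measurable_quotFun_eisensteinSeriesU_of_borel_invariant_cm_three {φ : (quasiSplit (↥(maximalRealSubfield L)) L (IsCMField.complexConj L) 3).Adelic → ℂ} (hφc : Continuous φ)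
    {M : ℝ} (hφM : ∀ x, ‖φ x‖ ≤ M)
    (hφB : ∀ b ∈ borelU ((IsCMField.complexConj L : L ≃ₐ[↥(maximalRealSubfield L)] L) : L →+* L) ((StdForm.antidiagonal 3).over L),
      ∀ x : (quasiSplit (↥(maximalRealSubfield L)) L (IsCMField.complexConj L) 3).Adelic, φ ((quasiSplit (↥(maximalRealSubfield L)) L (IsCMField.complexConj L) 3).toAdelic b * x) = φ x)
    {z : ℂ} (hz : 2 < z.re) :
    Measurable ((quasiSplit (↥(maximalRealSubfield L)) L (IsCMField.complexConj L) 3).quotFun (eisensteinSeriesU (flatSectionU φ z))) := by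
  have hEc := continuous_eisensteinSeriesU_flatSectionU_cm_three L hz hφc hφM
  refine measurable_quotFun_of_measurable hEc.measurable fun γ x => ?_
  obtain ⟨γ', hγ'⟩ := MonoidHom.mem_range.1 γ.2
  rw [← hγ']
  exact eisensteinSeriesU_flatSectionU_rational_mul hφB z γ' x

/-! ## §3 Membership in `𝓗_k(𝔛)` and the uniform norm bound, for a bounded continuous left-`B(F)`-invariant section -/

/-- **`E(f_z) ∈ 𝓗_k(𝔛)` FOR `2 < Re z ≤ k` AND ANY BOUNDED CONTINUOUS LEFT-`B(F)`-INVARIANT SECTION `φ`** (`U(2,1)_{L∕L⁺}`, `μ` finite on `𝔛`): `quotFun E(f_z) ∈ L²(𝔛, w₁^{−2k}dμ)` —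
★ FILE C `memLp_two_withDensity_supHeight_of_norm_le_mul_pow` with `hw :=` ★ `measurable_supHeight`, the floor ★ `exists_pos_forall_le_supHeight_cm_three`, and `hmod :=` §1 at `σ₁ = Re z`,
`σ₂ = k`, `g = x̃⁻¹` (★ `supHeight_eq_ciSup_arithmetic`); the twin of ★ (b1)₃ `eisensteinSeriesU_flatSectionU_memHX_cm_three` (`(ν, 𝓕)` are choices feeding the ★ cusp bound, not hypotheses on `E`).
[cite: BernsteinLapid2019, §4 (p. 10), §7] [cite: MoeglinWaldspurger1995, II.1.5, IV.1.8] -/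
theorem eisensteinSeriesU_flatSectionU_memHX_of_norm_le_cm_three (ν : Measure ↥(adelicUnipotent (↥(maximalRealSubfield L)) L (IsCMField.complexConj L) 3)) [ν.IsHaarMeasure] {𝓕 : Set ↥(adelicUnipotent (↥(maximalRealSubfield L)) L (IsCMField.complexConj L) 3)}
    (h𝓕N : IsFundamentalDomain ↥(rationalUnipotent (↥(maximalRealSubfield L)) L (IsCMField.complexConj L) 3) 𝓕 ν) (h𝓕c : IsCompact (closure 𝓕))
    (μ : Measure (quasiSplit (↥(maximalRealSubfield L)) L (IsCMField.complexConj L) 3).automorphicQuotient) [IsFiniteMeasure μ]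
    {φ : (quasiSplit (↥(maximalRealSubfield L)) L (IsCMField.complexConj L) 3).Adelic → ℂ} (hφc : Continuous φ) {M : ℝ} (hφM : ∀ x, ‖φ x‖ ≤ M)
    (hφB : ∀ b ∈ borelU ((IsCMField.complexConj L : L ≃ₐ[↥(maximalRealSubfield L)] L) : L →+* L) ((StdForm.antidiagonal 3).over L),
      ∀ x : (quasiSplit (↥(maximalRealSubfield L)) L (IsCMField.complexConj L) 3).Adelic, φ ((quasiSplit (↥(maximalRealSubfield L)) L (IsCMField.complexConj L) 3).toAdelic b * x) = φ x)
    (k : ℕ) {z : ℂ} (hz : 2 < z.re) (hzk : z.re ≤ k) :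
    MemLp ((quasiSplit (↥(maximalRealSubfield L)) L (IsCMField.complexConj L) 3).quotFun (eisensteinSeriesU (flatSectionU φ z))) 2
      (μ.withDensity fun x => (((K2E1BLBorelSpacesU2Defs.supHeight (↥(maximalRealSubfield L)) L (IsCMField.complexConj L) 3 x)⁻¹ ^ (2 * k) : ℝ≥0) : ℝ≥0∞)) := by
  obtain ⟨C, hC, hmaj⟩ := norm_eisensteinSeriesU_flatSectionU_le_uniform_of_norm_le_cm_three L ν h𝓕N h𝓕c hφM hz
  obtain ⟨c₀, hc₀, hwc⟩ := exists_pos_forall_le_supHeight_cm_three L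
  refine memLp_two_withDensity_supHeight_of_norm_le_mul_pow measurable_supHeight hc₀ hwc
    (measurable_quotFun_eisensteinSeriesU_of_borel_invariant_cm_three L hφc hφM hφB hz).aestronglyMeasurable (C := M * C) (n := k) (fun x => ?_) le_rfl
  rw [supHeight_eq_ciSup_arithmetic, ← Real.rpow_natCast]
  exact hmaj z le_rfl hzk (Quotient.out (x : (quasiSplit (↥(maximalRealSubfield L)) L (IsCMField.complexConj L) 3).Adelic ⧸ (quasiSplit (↥(maximalRealSubfield L)) L (IsCMField.complexConj L) 3).quotientSubgroup))⁻¹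

/-- **THE `𝓗_k(𝔛)`-NORM OF `E(f_z)` IS BOUNDED UNIFORMLY ON `{σ₁ ≤ Re z ≤ k}`** (`2 < σ₁ ≤ k`; bounded continuous left-`B(F)`-invariant `φ`): ONE constant `C` with
`‖toHX k μ E(f_z)‖ ≤ C` for all such `z` — §1's uniform majorant on `[σ₁, k]` and ★ `norm_toHX_le_of_norm_le_mul_supHeight_pow`; the domination input of the (χ,τ) holomorphy `z ↦ ι E(f_z)`.
[cite: BernsteinLapid2019, §4 (p. 10), §7] [cite: MoeglinWaldspurger1995, IV.1.8] -/
theorem norm_toHX_eisensteinSeriesU_le_uniform_of_norm_le_cm_three (ν : Measure ↥(adelicUnipotent (↥(maximalRealSubfield L)) L (IsCMField.complexConj L) 3)) [ν.IsHaarMeasure] {𝓕 : Set ↥(adelicUnipotent (↥(maximalRealSubfield L)) L (IsCMField.complexConj L) 3)}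
    (h𝓕N : IsFundamentalDomain ↥(rationalUnipotent (↥(maximalRealSubfield L)) L (IsCMField.complexConj L) 3) 𝓕 ν) (h𝓕c : IsCompact (closure 𝓕))
    (μ : Measure (quasiSplit (↥(maximalRealSubfield L)) L (IsCMField.complexConj L) 3).automorphicQuotient) [IsFiniteMeasure μ]
    {φ : (quasiSplit (↥(maximalRealSubfield L)) L (IsCMField.complexConj L) 3).Adelic → ℂ} (hφc : Continuous φ) {M : ℝ} (hφM : ∀ x, ‖φ x‖ ≤ M)
    (hφB : ∀ b ∈ borelU ((IsCMField.complexConj L : L ≃ₐ[↥(maximalRealSubfield L)] L) : L →+* L) ((StdForm.antidiagonal 3).over L),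
      ∀ x : (quasiSplit (↥(maximalRealSubfield L)) L (IsCMField.complexConj L) 3).Adelic, φ ((quasiSplit (↥(maximalRealSubfield L)) L (IsCMField.complexConj L) 3).toAdelic b * x) = φ x)
    (k : ℕ) {σ₁ : ℝ} (h1 : 2 < σ₁) :
    ∃ C : ℝ, 0 ≤ C ∧ ∀ z : ℂ, ∀ hz : σ₁ ≤ z.re, ∀ hzk : z.re ≤ k,
      ‖K2E1BLBorelSpacesU2Defs.toHX (↥(maximalRealSubfield L)) L (IsCMField.complexConj L) 3 k μ (eisensteinSeriesU (flatSectionU φ z))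
          (eisensteinSeriesU_flatSectionU_memHX_of_norm_le_cm_three L ν h𝓕N h𝓕c μ hφc hφM hφB k (h1.trans_le hz) hzk)‖ ≤ C := by
  have hM : 0 ≤ M := (norm_nonneg _).trans (hφM 1)
  obtain ⟨C, hC, hmaj⟩ := norm_eisensteinSeriesU_flatSectionU_le_uniform_of_norm_le_cm_three L ν h𝓕N h𝓕c hφM h1
  obtain ⟨c₀, hc₀, hwc⟩ := exists_pos_forall_le_supHeight_cm_three L
  refine ⟨M * C * ((μ univ) ^ (1 / 2 : ℝ)).toReal, by positivity, fun z hz hzk => ?_⟩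
  refine norm_toHX_le_of_norm_le_mul_supHeight_pow measurable_supHeight hc₀ hwc _ (mul_nonneg hM hC) fun x => ?_
  rw [supHeight_eq_ciSup_arithmetic, ← Real.rpow_natCast]
  exact hmaj z hz hzk (Quotient.out (x : (quasiSplit (↥(maximalRealSubfield L)) L (IsCMField.complexConj L) 3).Adelic ⧸ (quasiSplit (↥(maximalRealSubfield L)) L (IsCMField.complexConj L) 3).quotientSubgroup))⁻¹

/-! ## §4 The (χ,τ) prints: bounded continuous `χ`-sections -/

/-- **THE (χ,τ) PRINT AT N = 3: `E(f_z) ∈ 𝓗_k(𝔛)` FOR A BOUNDED CONTINUOUS `χ`-SECTION `φ`** (`IsChiSection χ φ`, ★ p859441 rank-generic; at N = 3 the `χ₂ = 1` sub-family — RULING S8-R10 (b): re-read on D-S8-3 `IsChiSectionPair` by the same line), `2 < Re z ≤ k` — §3 with the left-`B(F)`-invariance of `χ`-sections ★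
`IsChiSection.toAdelic_mul` (`χ` trivial on principal ideles); no unitarity of `χ`, no `K`-type datum needed. [cite: BernsteinLapid2019, §4 (p. 10), §7] [cite: MoeglinWaldspurger1995, I.2.17, II.1.5, IV.1.8] -/
theorem chiEisenstein_memHX_cm_three (ν : Measure ↥(adelicUnipotent (↥(maximalRealSubfield L)) L (IsCMField.complexConj L) 3)) [ν.IsHaarMeasure] {𝓕 : Set ↥(adelicUnipotent (↥(maximalRealSubfield L)) L (IsCMField.complexConj L) 3)}
    (h𝓕N : IsFundamentalDomain ↥(rationalUnipotent (↥(maximalRealSubfield L)) L (IsCMField.complexConj L) 3) 𝓕 ν) (h𝓕c : IsCompact (closure 𝓕))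
    (μ : Measure (quasiSplit (↥(maximalRealSubfield L)) L (IsCMField.complexConj L) 3).automorphicQuotient) [IsFiniteMeasure μ]
    (χ : HeckeCharacter L) {φ : (quasiSplit (↥(maximalRealSubfield L)) L (IsCMField.complexConj L) 3).Adelic → ℂ} (hχφ : IsChiSection χ φ) (hφc : Continuous φ) {M : ℝ} (hφM : ∀ x, ‖φ x‖ ≤ M)
    (k : ℕ) {z : ℂ} (hz : 2 < z.re) (hzk : z.re ≤ k) :
    MemLp ((quasiSplit (↥(maximalRealSubfield L)) L (IsCMField.complexConj L) 3).quotFun (eisensteinSeriesU (flatSectionU φ z))) 2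
      (μ.withDensity fun x => (((K2E1BLBorelSpacesU2Defs.supHeight (↥(maximalRealSubfield L)) L (IsCMField.complexConj L) 3 x)⁻¹ ^ (2 * k) : ℝ≥0) : ℝ≥0∞)) :=
  eisensteinSeriesU_flatSectionU_memHX_of_norm_le_cm_three L ν h𝓕N h𝓕c μ hφc hφM hχφ.toAdelic_mul k hz hzk

/-- **THE (χ,τ) PRINT AT N = 3, UNIFORM NORM BOUND FOR A BOUNDED CONTINUOUS `χ`-SECTION** («χ₂ = 1 sub-family; re-read on D-S8-3»): ONE `C` with `‖toHX k μ E(f_z)‖ ≤ C` on `{σ₁ ≤ Re z ≤ k}` (`2 < σ₁`) — §3 with ★ `IsChiSection.toAdelic_mul`.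
[cite: BernsteinLapid2019, §4 (p. 10), §7] [cite: MoeglinWaldspurger1995, I.2.17, IV.1.8] -/
theorem norm_toHX_chiEisenstein_le_uniform_cm_three (ν : Measure ↥(adelicUnipotent (↥(maximalRealSubfield L)) L (IsCMField.complexConj L) 3)) [ν.IsHaarMeasure] {𝓕 : Set ↥(adelicUnipotent (↥(maximalRealSubfield L)) L (IsCMField.complexConj L) 3)}
    (h𝓕N : IsFundamentalDomain ↥(rationalUnipotent (↥(maximalRealSubfield L)) L (IsCMField.complexConj L) 3) 𝓕 ν) (h𝓕c : IsCompact (closure 𝓕))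
    (μ : Measure (quasiSplit (↥(maximalRealSubfield L)) L (IsCMField.complexConj L) 3).automorphicQuotient) [IsFiniteMeasure μ]
    (χ : HeckeCharacter L) {φ : (quasiSplit (↥(maximalRealSubfield L)) L (IsCMField.complexConj L) 3).Adelic → ℂ} (hχφ : IsChiSection χ φ) (hφc : Continuous φ) {M : ℝ} (hφM : ∀ x, ‖φ x‖ ≤ M)
    (k : ℕ) {σ₁ : ℝ} (h1 : 2 < σ₁) :
    ∃ C : ℝ, 0 ≤ C ∧ ∀ z : ℂ, ∀ hz : σ₁ ≤ z.re, ∀ hzk : z.re ≤ k,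
      ‖K2E1BLBorelSpacesU2Defs.toHX (↥(maximalRealSubfield L)) L (IsCMField.complexConj L) 3 k μ (eisensteinSeriesU (flatSectionU φ z))
          (chiEisenstein_memHX_cm_three L ν h𝓕N h𝓕c μ χ hχφ hφc hφM k (h1.trans_le hz) hzk)‖ ≤ C :=
  norm_toHX_eisensteinSeriesU_le_uniform_of_norm_le_cm_three L ν h𝓕N h𝓕c μ hφc hφM hχφ.toAdelic_mul k h1

end Summit.HodgeConjecture.HodgeConjecture.Cruxes.H413.K2E1ChiEisensteinMemHXCMThree

end
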